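import Mathlib
import Summits.CriticalPhenomena.PercolationContinuityZ3.Theorems.PercNearOneGluingNoHeavyLowerTailSahiCombTriWDipoleCert

/-!
# The ONE-PARAMETER TILT CERTIFICATE `T(x)` for `TRI_W(a)` — typed conjecture and the reduction `TiltCertIndep → TriWIneq`

Support file of the one-cut programme (crux `NoHeavyLowerTail`, stmt-CriticalPhenomena-4575; lemma factory `prim-lf-1`, gen 32; memo
`FROM-prim-lf-1-gen32-TRANSLATE-RANK-AND-TILT.md` §3(c), §8).  In the dipole form of `triW P F G` (`…SahiCombTriWDipoleCert`: demand tokens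
`D₁, D₂, D₃`, supply tokens `A, B, E`, containment `(v,d) ≤ (w,u)` iff `v ⊆ w ∧ d ⊆ u`) consider the matrix `T(x)` whose blocks are

  `D₁ → A : [r ≤ c]`,   `D₁ → B : [r ≤ c]·x^{dist(r,c)}`,   `D₂ → B : [r ≤ c]`,   `D₃ → A : [r ≤ c]·x^{dist(r,c)}`,   `D₃ → E : [r ≤ c]`,

all other blocks `0`, where `dist((v,d),(w,u)) = #(w \ v) + #(u \ d)` (plain zeta on three blocks, `x`-tilted zeta on `D₁ → B` and `D₃ → A`; this
is the sparsity and bias placement of P5's design "339" with its four biases replaced by ONE parameter, which suffices for cylinders).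
CENSUS (this gen, kit j144008 + local): for generic `x` the demand rows of `T(x)` are linearly independent on EVERY configuration with
`#β + #γ ≤ 5` — exhaustive, 8,452,815 configurations at `#β + #γ = 5`, 0 rank-deficient — and on 96,000 random configurations at `6` (j144351);
every rigid specialisation (`x ∈ {0, ±1, 2, 3}`) and every other placement of two tilted blocks fails by `#β + #γ = 5` (memo §8).  Since a non-zero
polynomial has a rational non-root, "independent for generic `x`" is recorded as "independent for SOME `x : ℚ`" per configuration:

* `tiltCert P F x r c` — the entries of `T(x)`;  `tiltCert_ne_zero` — they are supported on the containment relation;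
* **`TiltCertIndep`** (`@[conjecture]`, an obligation of our theory, never a fact): for every up-set `P` and monotone family of up-sets `F` there is
  `x : ℚ` such that the rows of `T(x)` (indexed by `dipoleDem P F`, as vectors on `dipoleSup P F`) are linearly independent;
* **`triWIneq_of_tiltCertIndep : TiltCertIndep → TriWIneq`** (by `triW_nonneg_of_dipoleRankCert`).
HONEST LABEL: a definition, a typed conjecture (census-clean through `#β + #γ = 5`, NOT proved) and its reduction; `TriWIneq` stays OPEN. [this work]
-/

namespace Summit.CriticalPhenomena.PercolationContinuityZ3.Theorems

namespace FiveUpSet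

open Finset

variable {β γ : Type} [DecidableEq β] [Fintype β] [DecidableEq γ] [Fintype γ]

/-- The entries of the one-parameter tilt certificate `T(x)`: on the containment relation, plain zeta (`1`) on the blocks `D₁→A`, `D₂→B`, `D₃→E`,
tilted zeta `x ^ (#(w \ v) + #(u \ d))` on `D₁→B` and `D₃→A`, and `0` on the four remaining blocks and off the containment relation. [this work] -/
def tiltCert (x : ℚ) (r c : Token β γ) : ℚ :=
  if r.2.1 ⊆ c.2.1 ∧ r.2.2 ⊆ c.2.2 then
    (if (r.1 = 0 ∧ c.1 = 0) ∨ (r.1 = 1 ∧ c.1 = 1) ∨ (r.1 = 2 ∧ c.1 = 2) then (1 : ℚ)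
     else if (r.1 = 0 ∧ c.1 = 1) ∨ (r.1 = 2 ∧ c.1 = 0) then x ^ ((c.2.1 \ r.2.1).card + (c.2.2 \ r.2.2).card)
     else 0)
  else 0

omit [Fintype β] [Fintype γ] in
/-- `T(x)` is supported on the containment relation of the product cube. [this work] -/
theorem tiltCert_ne_zero (x : ℚ) (r c : Token β γ) (h : tiltCert x r c ≠ 0) : r.2.1 ⊆ c.2.1 ∧ r.2.2 ⊆ c.2.2 := by
  by_contra hn
  apply h
  unfold tiltCert
  rw [if_neg hn]

/-- **The one-parameter tilt certificate has independent rows** (CONJECTURE — an obligation of our theory, never a fact; memo §3(c)/§8).  For every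
finite index cube `Finset β`, fibre cube `Finset γ`, up-set `P` and monotone family of up-sets `F` there is a rational `x` such that the demand rows of
`T(x)` are linearly independent as vectors on the supply tokens.  Census: exhaustive for `#β + #γ ≤ 5` (8.45·10⁶ configurations at 5), sampled at 6;
generic `x` works in every tested configuration, no fixed rational `x` does. OPEN. [this work] -/
@[conjecture] def TiltCertIndep : Prop :=
  ∀ (β γ : Type) [DecidableEq β] [Fintype β] [DecidableEq γ] [Fintype γ]
    (P : Finset (Finset γ)) (F : Finset β → Finset (Finset γ)),
    IsUpperSet (P : Set (Finset γ)) → (∀ x, IsUpperSet (F x : Set (Finset γ))) → Monotone F →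
      ∃ x : ℚ, LinearIndependent ℚ (fun r : ↥(dipoleDem P F) => fun c : ↥(dipoleSup P F) => tiltCert x r.1 c.1)

/-- **`TiltCertIndep → TriWIneq`**: the tilt certificate is a dipole rank certificate (`triWIneq_of_dipoleRankCert`). [this work] -/
theorem triWIneq_of_tiltCertIndep (h : TiltCertIndep) : TriWIneq := by
  refine triWIneq_of_dipoleRankCert ?_
  intro β γ _ _ _ _ P F hP hF hFm
  obtain ⟨x, hx⟩ := h β γ P F hP hF hFm
  exact ⟨tiltCert x, fun r c hrc => tiltCert_ne_zero x r c hrc, hx⟩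

end FiveUpSet

end Summit.CriticalPhenomena.PercolationContinuityZ3.Theorems
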